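import Summits.CriticalPhenomena.SAWScalingLimit.Theses.SAWBrickWallHomotopy
import Summits.CriticalPhenomena.SAWScalingLimit.Theorems.SAWDevelopingMapHexTransferEmbSymmetryCovariance
import Literature.Probability.RandomPlanarGeometry.ConformalRestrictionProofs
import HarnessLib

/-!
# `ModulusUniversality`, line `birth`: stub T — exact affine transport of the hexagonal SAW law

Helper file (`--supports stmt-CriticalPhenomena-5790`) of the line `birth` / `registered` for the
crux `SAWBrickWallHomotopy.ModulusUniversality` (skeleton
`Summits/CriticalPhenomena/SAWScalingLimit/Cruxes/ModulusUniversality/Lines/birth.lean`): the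
registered stub T `stub_affineTransport`, proved.

For a homeomorphism `B` of the plane which is `ℝ`-homogeneous and affine on segments (here the
affinity `B(x + iy) = 2x + i(2/√3)y` of the line, the "jittered brick wall"), the generic
discretisation of `HexSAW.lean` (`embMeshVertices` = `{v | δ·emb v ∈ Ω}`, `embMeshGraph` = edges
whose rescaled segment lies in `Ω̄`, `embMeshDomain` = union of the largest components,
`embDomainGraph`, `EmbDomainSAW`, `embWeight`, `embLaw`) of a domain `Ω` by the embedded graph
`(G, B ∘ emb)` IS the discretisation of `B⁻¹ Ω = B.symm '' Ω` by `(G, emb)`: since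
`δ · B c = B (δ · c)`, `B [x, y] = [B x, B y]` and `B⁻¹ Ω̄ = cl (B⁻¹ Ω)`, the mesh vertex sets and
the mesh graphs are EQUAL (`embMeshVertices_affine`, `embMeshGraph_affine`), hence so are the
discrete domains and the `Ω_δ` graphs (`embMeshDomain_affine`, `embDomainGraph_affine`); the
identity on vertices is then an isomorphism of discrete domains realised on mesh points by `B`, so
the tree lemma `YbRelay.map_curve_embLaw_of_iso` transports the law pushed to curves
(`map_curve_embLaw_affine`), and `integral_map` turns this into the equality of curve integrals
for EVERY real `δ` (`integral_curve_embLaw_affine`; junk values coincide, no finiteness is used).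
Endpoint approximations correspond by `MarkedDomain.pt_map` and continuity + homogeneity of `B⁻¹`.
All bookkeeping tagged [folklore].
-/

noncomputable section

open MeasureTheory Filter Topology
open Literature.Probability.LatticeModels
open Literature.Probability.RandomPlanarGeometry

namespace Summit.CriticalPhenomena.SAWScalingLimit.Cruxes.ModulusUniversality.Birth

/-! ### `ℝ`-homogeneous, segment-affine homeomorphisms of the plane -/

section Linear

variable (B : ℂ ≃ₜ ℂ)
  (hBsmul : ∀ (r : ℝ) (z : ℂ), B ((r : ℂ) * z) = (r : ℂ) * B z)
  (hBline : ∀ (x y : ℂ) (c : ℝ), B (AffineMap.lineMap x y c) = AffineMap.lineMap (B x) (B y) c)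

include hBline in
/-- A segment-affine homeomorphism maps segments onto segments (as
`YbRelay.image_similarity_segment` for similarities). [folklore] -/
theorem image_segment_of_lineMap (x y : ℂ) :
    B '' segment ℝ x y = segment ℝ (B x) (B y) := by
  rw [segment_eq_image_lineMap, segment_eq_image_lineMap, Set.image_image]
  exact Set.image_congr fun t _ => hBline x y t

include hBsmul in
/-- The inverse of a real-homogeneous homeomorphism is real-homogeneous. [folklore] -/
theorem symm_real_mul (r : ℝ) (z : ℂ) : B.symm ((r : ℂ) * z) = (r : ℂ) * B.symm z := by
  apply B.injective
  rw [B.apply_symm_apply, hBsmul, B.apply_symm_apply]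

end Linear

/-! ### The discretisation of `B⁻¹ Ω` by `(G, emb)` is that of `Ω` by `(G, B ∘ emb)` -/

section Transport

variable {V : Type*} (G : SimpleGraph V) (emb : V → ℂ) (B : ℂ ≃ₜ ℂ)
  (hBsmul : ∀ (r : ℝ) (z : ℂ), B ((r : ℂ) * z) = (r : ℂ) * B z)
  (hBline : ∀ (x y : ℂ) (c : ℝ), B (AffineMap.lineMap x y c) = AffineMap.lineMap (B x) (B y) c)
  (Ω : Set ℂ) (δ : ℝ)

include hBsmul in
/-- Mesh vertices agree: `δ c ∈ B⁻¹ Ω ↔ δ (B c) ∈ Ω`. [folklore] -/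
theorem embMeshVertices_affine :
    SAW.embMeshVertices emb (B.symm '' Ω) δ = SAW.embMeshVertices (fun v => B (emb v)) Ω δ := by
  ext v
  simp only [SAW.mem_embMeshVertices_iff]
  rw [B.symm.image_eq_preimage_symm, Homeomorph.symm_symm, Set.mem_preimage, hBsmul]

include hBsmul hBline in
/-- Mesh graphs agree: `[δ c, δ c'] ⊆ cl (B⁻¹ Ω) ↔ [δ B c, δ B c'] ⊆ Ω̄`. [folklore] -/
theorem embMeshGraph_affine :
    SAW.embMeshGraph G emb (B.symm '' Ω) δ = SAW.embMeshGraph G (fun v => B (emb v)) Ω δ := by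
  ext x y
  rw [SAW.embMeshGraph_adj_iff, SAW.embMeshGraph_adj_iff, ← hBsmul, ← hBsmul,
    ← image_segment_of_lineMap B hBline, Set.image_subset_iff, B.symm.image_eq_preimage_symm,
    Homeomorph.symm_symm, B.preimage_closure]

include hBsmul hBline in
/-- The discrete domains (unions of the largest components of the mesh vertex graphs) agree.
[folklore] -/
theorem embMeshDomain_affine :
    SAW.embMeshDomain G emb (B.symm '' Ω) δ = SAW.embMeshDomain G (fun v => B (emb v)) Ω δ := by
  unfold SAW.embMeshDomain SAW.embMeshVertexGraph
  rw [embMeshVertices_affine emb B hBsmul Ω δ, embMeshGraph_affine G emb B hBsmul hBline Ω δ]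

include hBsmul hBline in
/-- The `Ω_δ` graphs agree: `(B⁻¹ Ω)_δ` for `(G, emb)` equals `Ω_δ` for `(G, B ∘ emb)` as graphs on
`V`. [folklore] -/
theorem embDomainGraph_affine :
    SAW.embDomainGraph G emb (B.symm '' Ω) δ = SAW.embDomainGraph G (fun v => B (emb v)) Ω δ := by
  unfold SAW.embDomainGraph
  rw [embMeshDomain_affine G emb B hBsmul hBline Ω δ, embMeshGraph_affine G emb B hBsmul hBline Ω δ]

include hBsmul hBline in
/-- **Transport of the law along `B`.** The law of `(B⁻¹ Ω)_δ` for `(G, emb)` at fugacity `x`,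
pushed to curves and then along `B`, is the law of `Ω_δ` for `(G, B ∘ emb)` pushed to curves: the
identity on vertices is an isomorphism of the two (equal) discrete domain graphs realised on mesh
points by the segment-affine map `B` (`YbRelay.map_curve_embLaw_of_iso`). [folklore] -/
theorem map_curve_embLaw_affine (x : ℝ) (a b : V) :
    ((SAW.embLaw G emb (B.symm '' Ω) δ x a b).map (fun γ => γ.curve)).map
        (CurveClass.map (B : C(ℂ, ℂ))) =
      (SAW.embLaw G (fun v => B (emb v)) Ω δ x a b).map (fun γ => γ.curve) :=
  Summit.CriticalPhenomena.SAWScalingLimit.Cruxes.HexTransfer.YbRelay.map_curve_embLaw_of_iso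
    ⟨Equiv.refl V, by
      intro u v
      rw [embDomainGraph_affine G emb B hBsmul hBline Ω δ]
      rfl⟩
    (B : C(ℂ, ℂ)) (fun u v c => hBline u v c) (fun v => hBsmul δ (emb v)) x rfl rfl

include hBsmul hBline in
/-- **Equality of curve integrals, for every real `δ`.** For a bounded continuous test function `f`
on curve space, `∫ f(curve) dP^{(G, B∘emb)}_{Ω,δ}(a,b) = ∫ f(B ∘ curve) dP^{(G,emb)}_{B⁻¹Ω,δ}(a,b)`
exactly (`integral_map` on both sides of `map_curve_embLaw_affine`; junk values coincide). [folklore] -/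
theorem integral_curve_embLaw_affine (x : ℝ) (a b : V)
    (f : BoundedContinuousFunction (CurveClass ℂ) ℝ) :
    (∫ γ, f γ.curve ∂(SAW.embLaw G (fun v => B (emb v)) Ω δ x a b)) =
      ∫ γ, f (CurveClass.map (B : C(ℂ, ℂ)) γ.curve) ∂(SAW.embLaw G emb (B.symm '' Ω) δ x a b) := by
  have h1 : (∫ γ, f γ.curve ∂(SAW.embLaw G (fun v => B (emb v)) Ω δ x a b)) =
      ∫ c, f c ∂((SAW.embLaw G (fun v => B (emb v)) Ω δ x a b).map (fun γ => γ.curve)) :=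
    (integral_map (SAW.EmbDomainSAW.measurable_of_top _).aemeasurable
      f.continuous.aestronglyMeasurable).symm
  rw [h1, ← map_curve_embLaw_affine G emb B hBsmul hBline Ω δ x a b,
    integral_map (CurveClass.measurable_map _).aemeasurable f.continuous.aestronglyMeasurable]
  exact integral_map (SAW.EmbDomainSAW.measurable_of_top _).aemeasurable
    (f.continuous.comp (CurveClass.continuous_map _)).aestronglyMeasurable

end Transport

/-! ### The registered stub -/

/-- **STUB T of line `birth` — `AffineTransport` (registered signature, literal).**  For the
affinity `B(x + iy) = 2x + i(2/√3)y`: (i) a jittered-brick-wall endpoint approximation of `E`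
(graph `hexGraph` embedded by `B ∘ hexCenter`) is a hexagonal endpoint approximation of
`B⁻¹ E = E.map B.symm` (`embDomainGraph_affine` for reachability; `MarkedDomain.pt_map`,
continuity and homogeneity of `B⁻¹` for the marked points), and (ii) for every real `δ` and every
bounded continuous `f` on curve space,
`∫ f(curve) dP^{jBW}_{E,δ}(a' δ, b' δ) = ∫ f(B ∘ curve) dP^{Hex}_{B⁻¹E,δ}(a' δ, b' δ)` exactly
(`integral_curve_embLaw_affine`; `hexSAWLaw` is `embLaw hexGraph hexCenter · · x_c`,
`(E.map B.symm).carrier = B.symm '' E.carrier`). [folklore] -/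
theorem stub_affineTransport : ∀ B : ℂ ≃ₜ ℂ, (∀ z : ℂ, B z = ((2 * z.re : ℝ) : ℂ) + ((2 / Real.sqrt 3 * z.im : ℝ) : ℂ) * Complex.I) → ∀ (E : DobrushinDomain) (a' b' : ℝ → HexVertex), SAW.IsEmbEndpointApprox hexGraph (fun v : HexVertex => B (hexCenter v)) E a' b' → SAW.IsEmbEndpointApprox hexGraph hexCenter (E.map B.symm) a' b' ∧ ∀ (δ : ℝ) (f : BoundedContinuousFunction (CurveClass ℂ) ℝ), (∫ γ, f γ.curve ∂(SAW.embLaw hexGraph (fun v : HexVertex => B (hexCenter v)) E.carrier δ SAW.hexCriticalFugacity (a' δ) (b' δ))) = ∫ γ, f (CurveClass.map (B : C(ℂ, ℂ)) γ.curve) ∂(SAW.hexSAWLaw (E.map B.symm).carrier δ (a' δ) (b' δ)) := by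
  intro B hB E a' b' h
  -- `B` is real-homogeneous and affine on segments
  have hBsmul : ∀ (r : ℝ) (z : ℂ), B ((r : ℂ) * z) = (r : ℂ) * B z := by
    intro r z
    simp only [hB]
    apply Complex.ext
    · simp only [Complex.add_re, Complex.mul_re, Complex.mul_im, Complex.ofReal_re,
        Complex.ofReal_im, Complex.I_re, Complex.I_im, Complex.add_im]
      ring
    · simp only [Complex.add_re, Complex.mul_re, Complex.mul_im, Complex.ofReal_re,
        Complex.ofReal_im, Complex.I_re, Complex.I_im, Complex.add_im]
      ring
  have hBline : ∀ (x y : ℂ) (c : ℝ),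
      B (AffineMap.lineMap x y c) = AffineMap.lineMap (B x) (B y) c := by
    intro x y c
    rw [AffineMap.lineMap_apply_module', AffineMap.lineMap_apply_module', Complex.real_smul,
      Complex.real_smul]
    simp only [hB]
    apply Complex.ext
    · simp only [Complex.add_re, Complex.add_im, Complex.sub_re, Complex.sub_im, Complex.mul_re,
        Complex.mul_im, Complex.ofReal_re, Complex.ofReal_im, Complex.I_re, Complex.I_im]
      ring
    · simp only [Complex.add_re, Complex.add_im, Complex.sub_re, Complex.sub_im, Complex.mul_re,
        Complex.mul_im, Complex.ofReal_re, Complex.ofReal_im, Complex.I_re, Complex.I_im]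
      ring
  refine ⟨⟨?_, ?_, ?_⟩, fun δ f => ?_⟩
  · -- reachability: the two `Ω_δ` graphs are equal
    refine h.reachable.mono fun δ hδ => ?_
    rw [MarkedDomain.carrier_map,
      embDomainGraph_affine hexGraph hexCenter B hBsmul hBline E.carrier δ]
    exact hδ
  · -- `δ c_{a' δ} = B⁻¹ (δ B c_{a' δ}) → B⁻¹ (E.pt 0)`
    rw [MarkedDomain.pt_map]
    refine ((B.symm.continuous.tendsto (E.pt 0)).comp h.tendsto_fst).congr fun δ => ?_
    rw [Function.comp_apply, symm_real_mul B hBsmul, B.symm_apply_apply]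
  · rw [MarkedDomain.pt_map]
    refine ((B.symm.continuous.tendsto (E.pt 1)).comp h.tendsto_snd).congr fun δ => ?_
    rw [Function.comp_apply, symm_real_mul B hBsmul, B.symm_apply_apply]
  · -- the exact identity of curve integrals
    rw [MarkedDomain.carrier_map]
    exact integral_curve_embLaw_affine hexGraph hexCenter B hBsmul hBline E.carrier δ
      SAW.hexCriticalFugacity (a' δ) (b' δ) f

end Summit.CriticalPhenomena.SAWScalingLimit.Cruxes.ModulusUniversality.Birth

end
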